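import Mathlib
import Literature.Analysis.FluidPDE.VectorCalculus
import Summits.NavierStokesRegularity.NavierStokesRegularity.Theorems.ThreadingFluxErtelTowerStagnationJetSlopes
import Summits.NavierStokesRegularity.NavierStokesRegularity.Theorems.UnthreadedDoorKinematicShadowPointSourceCalculus
import HarnessLib

/-!
# Crux `PoloidalLiouville` (stmt-NavierStokesRegularity-1222, W1), crux idea «radial-jerk-tower» (ns-idea-15 g7):
# FRÉCHET GERMS OF THE TOWER GRADIENTS AND OF THE DISCRIMINANT AT A STAGNATION CENTRE (smooth steady drift)

Support file (`--supports stmt-NavierStokesRegularity-1222`, helper).  Experiment cell `ns-wall-extremal`, width hand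
ns-wall-eng-5 g10, item (ε) E7a = first half of OPEN ITEM (i) of g9's record of custody (`HOME/ARM-B/shadow-eng5g9/README.md`:
«the SMOOTH (non-analytic) stagnation case»); second half = `…ErtelTowerStagnationConeTip` (E7b).  0 kit.  Theorem-only;
nothing of the sketch `Cruxes/PoloidalLiouville/ErtelTowerSketch.lean` is restated or closed.

E6a (`…ErtelTowerStagnationJetSlopes`) reads off, RAY BY RAY (`tendsto_slope_disc`), the cubic germ `D_A` of the discriminant
`D(x) = ⟪x − x₀, ∇θ₁(x) × ∇θ₂(x)⟫` of `inviscidKinematicRigidity` at a stagnation centre `x₀` (`u x₀ = 0`, `A = Du(x₀)`) of a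
smooth steady drift.  A cone-tip statement needs the germ UNIFORMLY IN THE DIRECTION, i.e. in the Fréchet sense; this file
proves it with first derivatives and continuity only (no Taylor expansion of the tower).  REGULARITY ACTUALLY USED: two
derivatives of `u` near `x₀` with `Du`, `D(Du·u)` continuous at `x₀` (so `C²` at `x₀` suffices); the hypothesis `ContDiffOn ℝ ⊤`
is kept only as the lineage's convention (E5/E6a/E6b):

* `isLittleO_apply_of_tendsto` (`o(1)·O(k) = o(k)` for operator-valued
  coefficients), `continuousAt_adjoint_fderiv` (`y ↦ (Du y)†` is continuous) — tools (`‖a × b‖ ≤ ‖a‖‖b‖` is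
  `KinematicShadow.PointSource.norm_cross_le`, imported);
* ★ `isLittleO_gradient_thetaOne_stagnation` — `∇θ₁(x) = A†(x − x₀) + A(x − x₀) + o(x − x₀)` (from E5's
  `∇θ₁ = (Du)†(x − x₀) + u`); `isBigO_drift_stagnation` (`u = O(x − x₀)`);
* ★ `isLittleO_gradient_thetaTwo_stagnation` — `∇θ₂(x) = A†A†(x − x₀) + AA(x − x₀) + 2A†A(x − x₀) + o(x − x₀)` (from E6a's
  `∇θ₂ = (DG)†(x − x₀) + G + 2(Du)†u`, `G = Du·u`, `DG(x₀) = A∘A`); `isBigO_gradient_thetaTwo_stagnation`;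
* ★★ `isLittleO_disc_stagnation` — **`D(x) = D_A(x − x₀) + o(‖x − x₀‖³)`**, `D_A(z) = ⟪z, (A† z + A z) × (A†A† z + AA z + 2A†A z)⟫`
  (the normal form of `tendsto_slope_disc`), the FRÉCHET upgrade of E6a's ray-wise limit;
* `jetCubic_eq` — E3's normal form of the cubic (`linDisc_ne_zero_or_axisymmetric`) equals this one; `jetCubic_smul` —
  homogeneity `D_A(t z) = t³ D_A(z)`; `continuous_jetCubic`.

HONEST FRAME: germ statements about the INVISCID shadow (frozen-field equation) in a prescribed SMOOTH steady drift;
information-grade helper under ⟨1222⟩; says nothing about NS; `PoloidalLiouville` (1222) / `UnthreadedRigidity` (27585) OPEN;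
NS regularity NOT proved.
-/

-- the summit and its single problem share the name (D-0017 nested layout)
set_option linter.dupNamespace false

noncomputable section

namespace Summit.NavierStokesRegularity.NavierStokesRegularity.Theorems.PoloidalLiouville.ErtelTower

open Set Function Filter Metric Topology Asymptotics
open scoped Topology RealInnerProductSpace InnerProductSpace ContDiff
open Literature.Analysis.FluidPDE
open Summit.NavierStokesRegularity.NavierStokesRegularity.Theorems.PoloidalLiouville.HorizonTower (E3)

/-! ### Tools -/

section Tools

/-- **`o(1) · O(k) = o(k)` for operator-valued coefficients.**  If `T x → T₀` along `l` and `g = O(k)`, then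
`(T x − T₀)(g x) = o(k)`. -/
theorem isLittleO_apply_of_tendsto {α : Type*} {l : Filter α} {T : α → E3 →L[ℝ] E3} {T₀ : E3 →L[ℝ] E3}
    (hT : Tendsto T l (𝓝 T₀)) {g k : α → E3} (hg : g =O[l] k) :
    (fun x => (T x - T₀) (g x)) =o[l] k := by
  have h1 : (fun x => T x - T₀) =o[l] (fun _ => (1 : ℝ)) := by
    rw [isLittleO_one_iff]
    exact tendsto_sub_nhds_zero_iff.mpr hT
  have h2 : (fun x => (T x - T₀) (g x)) =O[l] fun x => ‖T x - T₀‖ * ‖g x‖ :=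
    IsBigO.of_norm_le fun x => (T x - T₀).le_opNorm (g x)
  have h3 : (fun x => ‖T x - T₀‖ * ‖g x‖) =o[l] fun x => (1 : ℝ) * ‖k x‖ := h1.norm_left.mul_isBigO hg.norm_norm
  exact h2.trans_isLittleO ((h3.congr_right fun x => one_mul _).of_norm_right)

variable {u : E3 → E3} {U : Set E3} {x₀ : E3}

/-- `y ↦ (Du y)†` is continuous at `x₀` (operator-valued) for a drift smooth on an open `U ∋ x₀`. -/
theorem continuousAt_adjoint_fderiv (hU : IsOpen U) (hu : ContDiffOn ℝ (⊤ : ℕ∞) u U) (hx₀ : x₀ ∈ U) :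
    ContinuousAt (fun y : E3 => ContinuousLinearMap.adjoint (fderiv ℝ u y)) x₀ := by
  have hDu : ContinuousAt (fderiv ℝ u) x₀ :=
    (hu.continuousOn_fderiv_of_isOpen hU (by simp)).continuousAt (hU.mem_nhds hx₀)
  exact (ContinuousLinearMap.adjoint : (E3 →L[ℝ] E3) ≃ₗᵢ⋆[ℝ] (E3 →L[ℝ] E3)).continuous.continuousAt.comp hDu

end Tools

/-! ### Fréchet germs of the first two tower gradients at a stagnation centre -/

section Germs

variable {u : E3 → E3} {U : Set E3} {x₀ : E3}

/-- ★ **Fréchet germ of `∇θ₁` at a stagnation centre**: `∇θ₁(x) − (A†(x − x₀) + A(x − x₀)) = o(x − x₀)` as `x → x₀`,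
`A = Du(x₀)`, when `u x₀ = 0` (from `∇θ₁(x) = (Du x)†(x − x₀) + u x`: continuity of `(Du)†` and Fréchet differentiability
of `u` at `x₀`).  Uniform-in-direction form of E6a's `tendsto_slope_gradient_thetaOne`. -/
theorem isLittleO_gradient_thetaOne_stagnation (hU : IsOpen U) (hu : ContDiffOn ℝ (⊤ : ℕ∞) u U) (hx₀ : x₀ ∈ U)
    (hstag : u x₀ = 0) :
    (fun x : E3 => gradient (radialJerk (fun _ : ℝ => u) x₀ 1 0) x
        - (ContinuousLinearMap.adjoint (fderiv ℝ u x₀) (x - x₀) + fderiv ℝ u x₀ (x - x₀))) =o[𝓝 x₀]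
      fun x => x - x₀ := by
  have hud : DifferentiableAt ℝ u x₀ := (hu.differentiableOn (by simp)).differentiableAt (hU.mem_nhds hx₀)
  -- the two little-o pieces
  have h1 : (fun x : E3 => (ContinuousLinearMap.adjoint (fderiv ℝ u x) - ContinuousLinearMap.adjoint (fderiv ℝ u x₀))
      (x - x₀)) =o[𝓝 x₀] fun x => x - x₀ :=
    isLittleO_apply_of_tendsto (continuousAt_adjoint_fderiv hU hu hx₀) (isBigO_refl _ _)
  have h2 : (fun x : E3 => u x - u x₀ - fderiv ℝ u x₀ (x - x₀)) =o[𝓝 x₀] fun x => x - x₀ := hud.hasFDerivAt.isLittleO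
  refine (h1.add h2).congr' ?_ EventuallyEq.rfl
  filter_upwards [hU.mem_nhds hx₀] with x hx
  have hudx : DifferentiableAt ℝ u x := (hu.differentiableOn (by simp)).differentiableAt (hU.mem_nhds hx)
  rw [gradient_thetaOne_steady hudx, hstag, sub_apply]
  abel

/-- `u x = O(x − x₀)` at a stagnation centre. -/
theorem isBigO_drift_stagnation (hU : IsOpen U) (hu : ContDiffOn ℝ (⊤ : ℕ∞) u U) (hx₀ : x₀ ∈ U) (hstag : u x₀ = 0) :
    (fun x : E3 => u x) =O[𝓝 x₀] fun x => x - x₀ := by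
  have hud : DifferentiableAt ℝ u x₀ := (hu.differentiableOn (by simp)).differentiableAt (hU.mem_nhds hx₀)
  simpa [hstag] using hud.hasFDerivAt.isBigO_sub

/-- ★ **Fréchet germ of `∇θ₂` at a stagnation centre**: `∇θ₂(x) − (A†A†(x − x₀) + AA(x − x₀) + 2A†A(x − x₀)) = o(x − x₀)`,
`A = Du(x₀)`, when `u x₀ = 0` (from `∇θ₂ = (DG)†(x − x₀) + G + 2(Du)†u`, `G = Du·u`, `DG(x₀) = A∘A`, E6a).  Uniform form of
`tendsto_slope_gradient_thetaTwo`. -/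
theorem isLittleO_gradient_thetaTwo_stagnation (hU : IsOpen U) (hu : ContDiffOn ℝ (⊤ : ℕ∞) u U) (hx₀ : x₀ ∈ U)
    (hstag : u x₀ = 0) :
    (fun x : E3 => gradient (radialJerk (fun _ : ℝ => u) x₀ 2 0) x
        - (ContinuousLinearMap.adjoint (fderiv ℝ u x₀) (ContinuousLinearMap.adjoint (fderiv ℝ u x₀) (x - x₀))
          + fderiv ℝ u x₀ (fderiv ℝ u x₀ (x - x₀))
          + (2 : ℝ) • ContinuousLinearMap.adjoint (fderiv ℝ u x₀) (fderiv ℝ u x₀ (x - x₀)))) =o[𝓝 x₀]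
      fun x => x - x₀ := by
  have hud : DifferentiableAt ℝ u x₀ := (hu.differentiableOn (by simp)).differentiableAt (hU.mem_nhds hx₀)
  have hGd : HasFDerivAt (fun w => fderiv ℝ u w (u w)) ((fderiv ℝ u x₀).comp (fderiv ℝ u x₀)) x₀ :=
    hasFDerivAt_fderiv_apply_drift_centre hU hu hx₀ hstag
  have hG : ContDiffOn ℝ (⊤ : ℕ∞) (fun w => fderiv ℝ u w (u w)) U := (hu.fderiv_of_isOpen hU (by simp)).clm_apply hu
  -- (1) the `(DG)†` term
  have h1 : (fun x : E3 => (ContinuousLinearMap.adjoint (fderiv ℝ (fun w => fderiv ℝ u w (u w)) x)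
      - ContinuousLinearMap.adjoint (fderiv ℝ (fun w => fderiv ℝ u w (u w)) x₀)) (x - x₀)) =o[𝓝 x₀] fun x => x - x₀ :=
    isLittleO_apply_of_tendsto (continuousAt_adjoint_fderiv hU hG hx₀) (isBigO_refl _ _)
  rw [hGd.fderiv, ContinuousLinearMap.adjoint_comp] at h1
  -- (2) the `G` term
  have h2 : (fun x : E3 => fderiv ℝ u x (u x) - fderiv ℝ u x₀ (u x₀) - ((fderiv ℝ u x₀).comp (fderiv ℝ u x₀)) (x - x₀))
      =o[𝓝 x₀] fun x => x - x₀ := hGd.isLittleO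
  -- (3) the `2(Du)†u` term
  have h3 : (fun x : E3 => (ContinuousLinearMap.adjoint (fderiv ℝ u x) - ContinuousLinearMap.adjoint (fderiv ℝ u x₀)) (u x))
      =o[𝓝 x₀] fun x => x - x₀ :=
    isLittleO_apply_of_tendsto (continuousAt_adjoint_fderiv hU hu hx₀) (isBigO_drift_stagnation hU hu hx₀ hstag)
  have h4 : (fun x : E3 => ContinuousLinearMap.adjoint (fderiv ℝ u x₀) (u x - u x₀ - fderiv ℝ u x₀ (x - x₀)))
      =o[𝓝 x₀] fun x => x - x₀ :=
    ((ContinuousLinearMap.adjoint (fderiv ℝ u x₀)).isBigO_comp _ _).trans_isLittleO hud.hasFDerivAt.isLittleO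
  refine (h1.add (h2.add ((h3.add h4).const_smul_left (2 : ℝ)))).congr' ?_ EventuallyEq.rfl
  filter_upwards [hU.mem_nhds hx₀] with x hx
  rw [gradient_thetaTwo_steady hU hu hx, hstag]
  simp only [sub_apply, ContinuousLinearMap.comp_apply, Pi.smul_apply, map_sub, map_zero,
    smul_sub, smul_add, sub_zero]
  abel

/-- `∇θ₂(x) = O(x − x₀)` at a stagnation centre. -/
theorem isBigO_gradient_thetaTwo_stagnation (hU : IsOpen U) (hu : ContDiffOn ℝ (⊤ : ℕ∞) u U) (hx₀ : x₀ ∈ U)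
    (hstag : u x₀ = 0) :
    (fun x : E3 => gradient (radialJerk (fun _ : ℝ => u) x₀ 2 0) x) =O[𝓝 x₀] fun x => x - x₀ := by
  set S : E3 →L[ℝ] E3 := (ContinuousLinearMap.adjoint (fderiv ℝ u x₀)).comp (ContinuousLinearMap.adjoint (fderiv ℝ u x₀))
      + (fderiv ℝ u x₀).comp (fderiv ℝ u x₀)
      + (2 : ℝ) • (ContinuousLinearMap.adjoint (fderiv ℝ u x₀)).comp (fderiv ℝ u x₀) with hS
  have hlin : (fun x : E3 => S (x - x₀)) =O[𝓝 x₀] fun x => x - x₀ := S.isBigO_sub _ _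
  refine ((isLittleO_gradient_thetaTwo_stagnation hU hu hx₀ hstag).isBigO.add hlin).congr_left fun x => ?_
  simp only [hS, add_apply, smul_apply, ContinuousLinearMap.comp_apply]
  abel

/-- ★★ **FRÉCHET CUBIC GERM OF THE DISCRIMINANT AT A STAGNATION CENTRE.**  For a smooth steady drift `u` on an open `U ∋ x₀`
with `u x₀ = 0` and `A = Du(x₀)`:
`D(x) − D_A(x − x₀) = o(‖x − x₀‖³)` as `x → x₀`, where `D(x) = ⟪x − x₀, ∇θ₁(x) × ∇θ₂(x)⟫` is the discriminant of
`inviscidKinematicRigidity` and `D_A(z) = ⟪z, (A† z + A z) × (A†A† z + AA z + 2A†A z)⟫` the cubic of the linear drift (E1/E6a).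
This is UNIFORM in the direction — the Fréchet upgrade of E6a's ray-wise `tendsto_slope_disc`.  (Regularity used: `C²` near
`x₀`; `ContDiffOn ℝ ⊤` is the lineage's convention.) -/
theorem isLittleO_disc_stagnation (hU : IsOpen U) (hu : ContDiffOn ℝ (⊤ : ℕ∞) u U) (hx₀ : x₀ ∈ U) (hstag : u x₀ = 0) :
    (fun x : E3 => ⟪x - x₀, cross (gradient (radialJerk (fun _ : ℝ => u) x₀ 1 0) x)
        (gradient (radialJerk (fun _ : ℝ => u) x₀ 2 0) x)⟫
      - ⟪x - x₀, cross (ContinuousLinearMap.adjoint (fderiv ℝ u x₀) (x - x₀) + fderiv ℝ u x₀ (x - x₀))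
        (ContinuousLinearMap.adjoint (fderiv ℝ u x₀) (ContinuousLinearMap.adjoint (fderiv ℝ u x₀) (x - x₀))
          + fderiv ℝ u x₀ (fderiv ℝ u x₀ (x - x₀))
          + (2 : ℝ) • ContinuousLinearMap.adjoint (fderiv ℝ u x₀) (fderiv ℝ u x₀ (x - x₀)))⟫) =o[𝓝 x₀]
      fun x => ‖x - x₀‖ ^ 3 := by
  -- abbreviations
  set g₁ : E3 → E3 := fun x => gradient (radialJerk (fun _ : ℝ => u) x₀ 1 0) x with hg₁
  set g₂ : E3 → E3 := fun x => gradient (radialJerk (fun _ : ℝ => u) x₀ 2 0) x with hg₂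
  set S₁ : E3 →L[ℝ] E3 := ContinuousLinearMap.adjoint (fderiv ℝ u x₀) + fderiv ℝ u x₀ with hS₁
  set S₂ : E3 →L[ℝ] E3 := (ContinuousLinearMap.adjoint (fderiv ℝ u x₀)).comp (ContinuousLinearMap.adjoint (fderiv ℝ u x₀))
      + (fderiv ℝ u x₀).comp (fderiv ℝ u x₀)
      + (2 : ℝ) • (ContinuousLinearMap.adjoint (fderiv ℝ u x₀)).comp (fderiv ℝ u x₀) with hS₂
  have hS₁app : ∀ z : E3, S₁ z = ContinuousLinearMap.adjoint (fderiv ℝ u x₀) z + fderiv ℝ u x₀ z := fun z => by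
    simp only [hS₁, add_apply]
  have hS₂app : ∀ z : E3, S₂ z = ContinuousLinearMap.adjoint (fderiv ℝ u x₀) (ContinuousLinearMap.adjoint (fderiv ℝ u x₀) z)
      + fderiv ℝ u x₀ (fderiv ℝ u x₀ z) + (2 : ℝ) • ContinuousLinearMap.adjoint (fderiv ℝ u x₀) (fderiv ℝ u x₀ z) := fun z => by
    simp only [hS₂, add_apply, smul_apply, ContinuousLinearMap.comp_apply]
  -- the germs of `g₁`, `g₂`
  have hφ₁ : (fun x : E3 => g₁ x - S₁ (x - x₀)) =o[𝓝 x₀] fun x => x - x₀ := by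
    simpa only [hg₁, hS₁app] using isLittleO_gradient_thetaOne_stagnation hU hu hx₀ hstag
  have hφ₂ : (fun x : E3 => g₂ x - S₂ (x - x₀)) =o[𝓝 x₀] fun x => x - x₀ := by
    simpa only [hg₂, hS₂app] using isLittleO_gradient_thetaTwo_stagnation hU hu hx₀ hstag
  have hg₂O : g₂ =O[𝓝 x₀] fun x => x - x₀ := isBigO_gradient_thetaTwo_stagnation hU hu hx₀ hstag
  have hS₁O : (fun x : E3 => S₁ (x - x₀)) =O[𝓝 x₀] fun x => x - x₀ := S₁.isBigO_sub _ _
  -- the two error terms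
  have hT₁ : (fun x : E3 => ⟪x - x₀, cross (g₁ x - S₁ (x - x₀)) (g₂ x)⟫) =o[𝓝 x₀] fun x => ‖x - x₀‖ ^ 3 := by
    have hb : (fun x : E3 => ⟪x - x₀, cross (g₁ x - S₁ (x - x₀)) (g₂ x)⟫) =O[𝓝 x₀]
        fun x => ‖x - x₀‖ * (‖g₁ x - S₁ (x - x₀)‖ * ‖g₂ x‖) :=
      IsBigO.of_norm_le fun x => (norm_inner_le_norm _ _).trans
        (mul_le_mul_of_nonneg_left (KinematicShadow.PointSource.norm_cross_le _ _) (norm_nonneg _))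
    have ho : (fun x : E3 => ‖x - x₀‖ * (‖g₁ x - S₁ (x - x₀)‖ * ‖g₂ x‖)) =o[𝓝 x₀]
        fun x => ‖x - x₀‖ * (‖x - x₀‖ * ‖x - x₀‖) :=
      (isBigO_refl _ _).mul_isLittleO (hφ₁.norm_norm.mul_isBigO hg₂O.norm_norm)
    exact hb.trans_isLittleO (ho.congr_right fun x => by ring)
  have hT₂ : (fun x : E3 => ⟪x - x₀, cross (S₁ (x - x₀)) (g₂ x - S₂ (x - x₀))⟫) =o[𝓝 x₀] fun x => ‖x - x₀‖ ^ 3 := by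
    have hb : (fun x : E3 => ⟪x - x₀, cross (S₁ (x - x₀)) (g₂ x - S₂ (x - x₀))⟫) =O[𝓝 x₀]
        fun x => ‖x - x₀‖ * (‖S₁ (x - x₀)‖ * ‖g₂ x - S₂ (x - x₀)‖) :=
      IsBigO.of_norm_le fun x => (norm_inner_le_norm _ _).trans
        (mul_le_mul_of_nonneg_left (KinematicShadow.PointSource.norm_cross_le _ _) (norm_nonneg _))
    have ho : (fun x : E3 => ‖x - x₀‖ * (‖S₁ (x - x₀)‖ * ‖g₂ x - S₂ (x - x₀)‖)) =o[𝓝 x₀]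
        fun x => ‖x - x₀‖ * (‖x - x₀‖ * ‖x - x₀‖) :=
      (isBigO_refl _ _).mul_isLittleO (hS₁O.norm_norm.mul_isLittleO hφ₂.norm_norm)
    exact hb.trans_isLittleO (ho.congr_right fun x => by ring)
  -- the algebraic identity `D − D_A = T₁ + T₂`
  refine (hT₁.add hT₂).congr_left fun x => ?_
  rw [← hS₁app (x - x₀), ← hS₂app (x - x₀)]
  simp only [hg₁, hg₂, ← crossCLM_apply, map_sub, sub_apply, inner_sub_right]
  ring

end Germs

/-! ### The cubic `D_A`: normal forms, homogeneity, continuity -/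

section Cubic

/-- The normal form of the jet cubic used in E3 `linDisc_ne_zero_or_axisymmetric` equals the normal form of E6a
`tendsto_slope_disc` / this file:  `⟪z, ((A + A†) z) × (A†((A + A†) z) + (A + A†)(A z))⟫ = ⟪z, (A† z + A z) × (A†A† z + AA z + 2A†A z)⟫`. -/
theorem jetCubic_eq (A : E3 →L[ℝ] E3) (z : E3) :
    ⟪z, cross ((A + ContinuousLinearMap.adjoint A) z)
      ((ContinuousLinearMap.adjoint A) ((A + ContinuousLinearMap.adjoint A) z)
        + (A + ContinuousLinearMap.adjoint A) (A z))⟫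
    = ⟪z, cross (ContinuousLinearMap.adjoint A z + A z)
      (ContinuousLinearMap.adjoint A (ContinuousLinearMap.adjoint A z) + A (A z)
        + (2 : ℝ) • ContinuousLinearMap.adjoint A (A z))⟫ := by
  have h1 : (A + ContinuousLinearMap.adjoint A) z = ContinuousLinearMap.adjoint A z + A z := by
    rw [add_apply, add_comm]
  have h2 : (ContinuousLinearMap.adjoint A) ((A + ContinuousLinearMap.adjoint A) z) + (A + ContinuousLinearMap.adjoint A) (A z)
      = ContinuousLinearMap.adjoint A (ContinuousLinearMap.adjoint A z) + A (A z)
        + (2 : ℝ) • ContinuousLinearMap.adjoint A (A z) := by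
    simp only [add_apply, map_add, two_smul]
    abel
  rw [h2, h1]

/-- **Homogeneity**: `D_A(t z) = t³ D_A(z)`. -/
theorem jetCubic_smul (A : E3 →L[ℝ] E3) (t : ℝ) (z : E3) :
    ⟪t • z, cross (ContinuousLinearMap.adjoint A (t • z) + A (t • z))
      (ContinuousLinearMap.adjoint A (ContinuousLinearMap.adjoint A (t • z)) + A (A (t • z))
        + (2 : ℝ) • ContinuousLinearMap.adjoint A (A (t • z)))⟫
    = t ^ 3 * ⟪z, cross (ContinuousLinearMap.adjoint A z + A z)
      (ContinuousLinearMap.adjoint A (ContinuousLinearMap.adjoint A z) + A (A z)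
        + (2 : ℝ) • ContinuousLinearMap.adjoint A (A z))⟫ := by
  have h1 : ContinuousLinearMap.adjoint A (t • z) + A (t • z) = t • (ContinuousLinearMap.adjoint A z + A z) := by
    simp only [map_smul, smul_add]
  have h2 : ContinuousLinearMap.adjoint A (ContinuousLinearMap.adjoint A (t • z)) + A (A (t • z))
        + (2 : ℝ) • ContinuousLinearMap.adjoint A (A (t • z))
      = t • (ContinuousLinearMap.adjoint A (ContinuousLinearMap.adjoint A z) + A (A z)
        + (2 : ℝ) • ContinuousLinearMap.adjoint A (A z)) := by
    simp only [map_smul, smul_add, smul_comm (2 : ℝ) t]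
  rw [h1, h2]
  simp only [← crossCLM_apply, map_smul, smul_apply, real_inner_smul_left, real_inner_smul_right]
  ring

/-- The jet cubic `D_A` is continuous. -/
theorem continuous_jetCubic (A : E3 →L[ℝ] E3) :
    Continuous fun z : E3 => ⟪z, cross (ContinuousLinearMap.adjoint A z + A z)
      (ContinuousLinearMap.adjoint A (ContinuousLinearMap.adjoint A z) + A (A z)
        + (2 : ℝ) • ContinuousLinearMap.adjoint A (A z))⟫ := by
  have hf : Continuous fun z : E3 => ContinuousLinearMap.adjoint A z + A z := by fun_prop
  have hg : Continuous fun z : E3 => ContinuousLinearMap.adjoint A (ContinuousLinearMap.adjoint A z) + A (A z)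
      + (2 : ℝ) • ContinuousLinearMap.adjoint A (A z) := by fun_prop
  have hc : Continuous fun z : E3 => crossCLM (ContinuousLinearMap.adjoint A z + A z)
      (ContinuousLinearMap.adjoint A (ContinuousLinearMap.adjoint A z) + A (A z)
        + (2 : ℝ) • ContinuousLinearMap.adjoint A (A z)) :=
    crossCLM.continuous₂.comp (hf.prodMk hg)
  have hi : Continuous fun z : E3 => z := continuous_id
  simpa only [crossCLM_apply] using hi.inner hc

end Cubic

end Summit.NavierStokesRegularity.NavierStokesRegularity.Theorems.PoloidalLiouville.ErtelTower

end
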